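import Summits.QuantumFields.BalabanUV.T4Continuum.Support.B13StepOfRecordSubstrateBalaban

/-!
# B13StepOfRecordSubstrateBalabanUniform — NE5 ∕ U3: the η-UNIFORM form of `B13StepOfRecordSubstrateBalaban` (E8[rec] at the substrate's O1 instance with W1
# produced at Bałaban's tier-B background): ONE constant for every driven two-run object and every letter package — p221190 §4
# `uniform_ne5_of_substrate_restrict_secant_structural` with `hwer` supplied by `SubstrateO1Readings` (p225064) BY NAME

Cell `pub-balaban`, unit `b2b-balaban-t4-ne5-formalise-leaf-01` (NE5 formalisation swarm, LEAF PROVER 01, gen 16; journal INTENT `HOME/CLAIMS.log` l.17590;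
companion of `B13StepOfRecordSubstrateBalaban` §1, split from it for the 400-line rule — same header, same honesty clauses, same census conventions).
Imports the companion only (through it `B13StepOfRecordSubstrate` p221190, `B13StepEndInsOpBalaban` p225077 §1, `SubstrateO1Readings` p225064); 0 `def`,
0 cite tags, 0 sorry; compositions BY NAME.  HONEST FRAMING: rung (B)+1 of the FINITE-VOLUME T⁴ continuum programme — NOT infinite volume, NOT a mass gap,
NOT the Clay problem, **NOT A PROOF OF NE5** (NOT PRINTED; GAPS G-t4-U3-1), NOT a proof of NE2 or NE3: an IMPLICATION whose wall binders (U1b's `NE3Shape`,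
the (3.35)-class ∕ threshold letters, the owner's O1 letters at the substrate's tables, p221190's letter conditions and every E8[rec] binder) are DISPLAYED
HYPOTHESES about the substrate's letters, asserted nowhere; W1 RELOCATED to `NE3Shape` + letters, NOT discharged; nothing of the instance constructed (R34),
no species reading defined (R41); headline wording «END ⇐ instance letters», never «leaf instantiated»; 0∕12; spine 0∕9.  R48 ∕ R49 HONEST LINE: value-table
model, Road D of record for MI-R.  HONEST DEPENDENCY (cell line, verbatim): continuum YM on T⁴ ⇐ BetaPertH ∧ nine spine estimates (0/9 proved); BetaPertH ⇐
(D1) ∧ (D4) ∧ CAP+tail; G-an2-4 gates asym, D1 and NE2/3/4.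

WHAT: **`uniform_ne5_of_substrate_restrict_secant_structural_balaban_ne3Shape`** — the SIZES (`κ Nbar ε εop Rt EA₀ E₀ cA cB r₀ Gi δI ρ₁ θ′ ω ρ₀ k₁`, W1's
constant letters `o d L a α β C a′ B₁ B₂ B₃ Λ₂ … Λ₅`, U1b's `θ < 1`) fixed OUTSIDE; then `∃ C₅, ∀ 𝔾 D ιr cc ag sg … Lsl … iopAt 𝒞 Nl dom RgV tow …` with EVERY
per-object hypothesis (`hreg hNE3 hdec … hR`, p221190 §1's letter conditions, §2's factorisation, the E8[rec] binders) INSIDE — p221190 §4 with `hwer`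
SUPPLIED per object by `weightedEntrywiseRate_slotsOfRecord_balaban_ne3Shape`, `hc₁ ∕ hθ0 ∕ hθ1` by p225077 §1 (`c1_balaban_nonneg`, `sqrt_rate_pos_lt_one`);
conclusion LITERALLY `T4OutputRate.NE5 (B13StepOfRecord.outA (slotsOfRecord …) E₀ cB) (B13StepOfRecord.outB (slotsOfRecord …) E₀ cB) W κ θ′ C₅`.  CENSUS vs
p221190 §4: outer MINUS = [hc₁, hθ0, hθ1 (W1 rate), letters c₁ θ]; outer PLUS = [hL hd hα hβ hC ha′ hαη hβη hη B₁ B₂ B₃ Λ₂ … Λ₅ hΛ₂ … hΛ₅ θ (U1b) hθ1 (U1b)];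
inner MINUS = [hwer]; inner PLUS = [𝒞 Nl dom RgV tow σ dist₁ δ₁ S₂ Φ dist₂ δ₂ σX S₃ Ψ dist₃ δ₃ σB + the arrows hreg hNE3 hdec hcovA hcovB hdom₁ hΦ hS₂ hdecΦ
hΔA hΔB hdom₂ hΨ hS₃ hdecΨ hΓA hΓB hdom₃ hQ hR]; renames `Φ ↦ Φc`, `hdec ↦ hdecAct`; rest IDENTICAL.  Axioms ⊆ {propext, Classical.choice, Quot.sound}.
-/

noncomputable section

open scoped BigOperators ComplexConjugate Matrix Matrix.Norms.L2Operator Kronecker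
open Metric Set MeasureTheory

namespace Summit.QuantumFields.BalabanUV.T4Continuum.B13StepOfRecordSubstrateBalabanUniform

open Literature.MathematicalPhysics.QuantumFieldTheory.Balaban1983to89
open Literature.MathematicalPhysics.QuantumFieldTheory.Balaban1983to89.T4OutputRate (DecayBound NE5)
open Literature.MathematicalPhysics.QuantumFieldTheory.Balaban1983to89.T4InputCauchyRateSpecies (ballClass)
open Literature.MathematicalPhysics.QuantumFieldTheory.Balaban1983to89.B5Prop11Plancherel (Cst Cst_nonneg Tor fine)
open Literature.MathematicalPhysics.QuantumFieldTheory.Balaban1983to89.B5G183RateUnitTower (lev lev_neZero)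
open Literature.MathematicalPhysics.QuantumFieldTheory.Balaban1983to89.T4EtaRateMin (LocalRate NE3Shape)
open Summit.QuantumFields.BalabanUV.T4Continuum
open Summit.QuantumFields.BalabanUV.T4Continuum.B13Carriers (TwoRuns)
open Summit.QuantumFields.BalabanUV.T4Continuum.B13OpDatum (OpDatum Species FormatBounded B13Weights)
open Summit.QuantumFields.BalabanUV.T4Continuum.B13OpDatumJunctions (opOf RawBounded WeightedEntrywiseRate)
open Summit.QuantumFields.BalabanUV.T4Continuum.B13OpMeasurable (measOp)
open Summit.QuantumFields.BalabanUV.T4Continuum.B13HistMeasurable (MeasPotFrame B13HistM)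
open Summit.QuantumFields.BalabanUV.T4Continuum.B13StepTermLabels (InnerLabel)
open Summit.QuantumFields.BalabanUV.T4Continuum.B13StepTermFamily (ActData ActExpLinearOn)
open Summit.QuantumFields.BalabanUV.T4Continuum.B13StepTermSocket (labelsIndexing)
open Summit.QuantumFields.BalabanUV.T4Continuum.B13InnerData (Bnd b13InnerData)
open Summit.QuantumFields.BalabanUV.T4Continuum.UrsellTermBudget (actSum)
open Summit.QuantumFields.BalabanUV.T4Continuum.B13TermHistSecant (ActExpNormBound ActAbsBound)
open Summit.QuantumFields.BalabanUV.T4Continuum.B13DomainGeometryTR (domainGeometry)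
open Summit.QuantumFields.BalabanUV.T4Continuum.B13Base (selfCtr)
open Summit.QuantumFields.BalabanUV.T4Continuum.B13StepOfRecord (Slots assembly step)
open Summit.QuantumFields.BalabanUV.T4Continuum.OutputRateActOpFibre (ActOpFibre)
open Summit.QuantumFields.BalabanUV.T4Continuum.OutputRateInsertionStructural (InsOpComposition)
open Summit.QuantumFields.BalabanUV.T4Continuum.B13StepOfRecordSub (assemblyOn stepOn restrict opA_mem_measOp opB_mem_measOp)
open Summit.QuantumFields.BalabanUV.T4Continuum.B13StepOfRecordSubstrate (opA_mem_measOp_slotsOfRecord opB_mem_measOp_slotsOfRecord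
  ne5_of_substrate_restrict_secant_structural uniform_ne5_of_substrate_restrict_secant_structural)
open Summit.QuantumFields.BalabanUV.T4Continuum.B13StepEndInsOpBalaban (sqrt_rate_pos_lt_one c1_balaban_nonneg)
open Summit.QuantumFields.BalabanUV.T4Continuum.B13ReadingsDecay (ReadsTowerCovA ReadsTowerCovB CovWeightDominatesDist)
open Summit.QuantumFields.BalabanUV.T4Continuum.B13ReadingsImage
open Summit.QuantumFields.BalabanUV.T4Continuum.B13ReadingsLocal (PotQLipschitzReading PotRLipschitzReading)
open Summit.QuantumFields.BalabanUV.T4Continuum.B13ReadingsAssembly (CpertRec)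
open Summit.QuantumFields.BalabanUV.T4Continuum.SubstrateO1Readings (weightedEntrywiseRate_slotsOfRecord_balaban_ne3Shape)
open Summit.QuantumFields.BalabanUV.T4Continuum.DecayRateInterpolation (EntryDecay)
open Summit.QuantumFields.BalabanUV.T4Continuum.CovariantBlockAveraging (ContourSystem)
open Summit.QuantumFields.BalabanUV.T4Continuum.SubstrateBackgroundTransporters (unitMod)
open Summit.QuantumFields.BalabanUV.T4Continuum.SubstrateTwoRunsDriven (DrivenRuns)
open Summit.QuantumFields.BalabanUV.T4Continuum.SubstrateRawSpecies
open Summit.QuantumFields.BalabanUV.T4Continuum.SubstrateSlotsOfRecord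
open Summit.QuantumFields.BalabanUV.T4Continuum.BalabanAveragedTowerUnit (idx Qlev)
open Summit.QuantumFields.BalabanUV.T4Continuum.GaugeTermScalarData (QuT Q1)
open Summit.QuantumFields.BalabanUV.T4Continuum.RegularSiteTransporters (siteT)
open Summit.QuantumFields.BalabanUV.T4Continuum.RegularBackgroundTower (RegularTransporters)
open Summit.QuantumFields.BalabanUV.T4Continuum.NE2ColourPerturbedLayer (pertCovC)
open Summit.QuantumFields.BalabanUV.T4Continuum.NE2BalabanRoot (balabanPert)
open Summit.QuantumFields.BalabanUV.T4Continuum.NE2BalabanGauge (gaugeSlot liftR)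
open Summit.QuantumFields.BalabanUV.T4Continuum.NE2BalabanThreshold (etaStar)
open Summit.QuantumFields.BalabanUV.T4Continuum.NE2FromNE3Carrier (ne2Loc)
open Summit.QuantumFields.BalabanUV.T4Continuum.MinimalActionRate (minActReadings)

/-! ## §2 One constant for every driven two-run object and every letter package (η-uniformity at the substrate's instance) -/

section Uniform

variable {d : ℕ} (L : ℕ) [NeZero L] (M : Fin d → ℕ) [hM : ∀ μ, NeZero (M μ)] (a : ℝ) (ha : 0 < a)
variable {o : Type*} [Fintype o] [DecidableEq o] {α β C a' η : ℝ} {m : Type*} [Fintype m] [DecidableEq m]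

/-- [folklore] **ONE CONSTANT FOR EVERY DRIVEN TWO-RUN OBJECT AND EVERY LETTER PACKAGE (η-UNIFORMITY AT THE SUBSTRATE's O1 INSTANCE), W1 PRODUCED AT
BAŁABAN's TIER-B BACKGROUND** — p221190 §4 `uniform_ne5_of_substrate_restrict_secant_structural` (itself p219431 §2 at the instance) with `c₁ :=` W1's assembled
constant and `θ := √(max θ L⁻¹)` (both SIZES), its `hwer` binder supplied per two-run object and letter package by substrate-p1's
`weightedEntrywiseRate_slotsOfRecord_balaban_ne3Shape`, `hc₁ ∕ hθ0 ∕ hθ1` by p225077 §1.  Fix the SIZES (`κ Nbar ε εop Rt EA₀ E₀ cA cB r₀ Gi δI ρ₁ θ′ ω ρ₀ k₁`,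
W1's constant letters `o d L a α β C a′ B₁ B₂ B₃ Λ₂ … Λ₅`, U1b's `θ < 1`), subject to `√(max θ L⁻¹) ≤ θ′ ≤ 1`, the rooms and `hsmall`.  Then ONE `C₅` serves
EVERY gauge group `𝔾`, driven two-run object `D : DrivenRuns 𝔾`, representation `ιr`, letters `cc ag sg`, frame `Pm`, insertion-operator sort `IOp`, factor
index data `𝒵 domZ Jc Vv mI`, EVERY letter package `Lsl` with `Lsl.ins.ω = ω` satisfying p221190 §1's six letter conditions and §2's factorisation,
admissible data `dom ∕ 𝒞 ∕ Nl ∕ RgV` in the (3.35)-class and in U1b's shape `NE3Shape … C θ`, towers over `D`'s run-B backgrounds, O1 letters at the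
substrate's tables, window, radii, majorants, datum, insertion-composition data: the displayed binders IMPLY `NE5 (B13StepOfRecord.outA (slotsOfRecord …) E₀ cB)
(B13StepOfRecord.outB (slotsOfRecord …) E₀ cB) W κ θ′ C₅`.  NOT a proof of NE5 ∕ NE2 ∕ NE3: an implication from displayed binders, the quantifier order
`∃ C₅, ∀ 𝔾 D … Lsl …` being the point. -/
theorem uniform_ne5_of_substrate_restrict_secant_structural_balaban_ne3Shape (hL : 2 ≤ L) (hd : 1 ≤ d) (hα : 0 ≤ α) (hβ : 0 ≤ β)
    (hC : 0 ≤ C) (ha' : 0 < a') (hαη : α ≤ η) (hβη : β ≤ η) (hη : η ≤ etaStar o d a a') {B₁ B₂ B₃ Λ₂ Λ₃ Λ₄ Λ₅ : ℝ}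
    (hΛ₂ : 0 ≤ Λ₂) (hΛ₃ : 0 ≤ Λ₃) (hΛ₄ : 0 ≤ Λ₄) (hΛ₅ : 0 ≤ Λ₅) {θ : ℝ} (hθ1 : θ < 1)
    {κ Nbar ε εop Rt EA₀ E₀ cA cB r₀ Gi δI ρ₁ θ' ω ρ₀ : ℝ} {k₁ : ℕ}
    (hκ : 0 ≤ κ) (hNbar : 0 ≤ Nbar) (hε : 0 ≤ ε) (hεop : 0 ≤ εop) (hRt : 64 * Real.log 162 + 64 ≤ Rt)
    (hΦsmall : 36 * (ε * Real.exp 64 * B12TreeDecay.K₀ (4 * 2 ^ 4) (2 * 4)) < 1)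
    (hΦopsmall : 36 * (εop * Real.exp 64 * B12TreeDecay.K₀ (4 * 2 ^ 4) (2 * 4)) < 1)
    (hEA₀ : 0 ≤ EA₀) (hE₀ : 0 ≤ E₀) (hcA : 0 ≤ cA) (hcB : 0 ≤ cB) (hr₀ : 0 < r₀)
    (hGi : 0 ≤ Gi) (hδI : 0 ≤ δI) (hρ₁ : ρ₁ < 1) (hreachI : δI * Real.sqrt (max θ ((L : ℝ)⁻¹)) ^ k₁ ≤ ρ₁)
    (hθθ' : Real.sqrt (max θ ((L : ℝ)⁻¹)) ≤ θ') (hθ'1 : θ' ≤ 1) (hω : 0 < ω) (hω1 : ω < 1) (hρ₀ : 0 < ρ₀) (hρ₀1 : ρ₀ < 1)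
    (hsmall : ω + 2 * (Nbar * ((ε * Real.exp 64 * B12TreeDecay.K₀ (4 * 2 ^ 4) (2 * 4)) /
          (1 - 36 * (ε * Real.exp 64 * B12TreeDecay.K₀ (4 * 2 ^ 4) (2 * 4))) ^ 2)) * cA < θ') :
    ∃ C₅ : ℝ, ∀ {𝔾 : Type} [GaugeGroup 𝔾] (D : DrivenRuns 𝔾) {oc : Type} [Fintype oc] [DecidableEq oc] (ιr : 𝔾 →* Matrix oc oc ℂ) (cc : ℂ)
      (ag : ℝ) (sg : ℕ → ℂ) {T ι' Sy Ω 𝒴 : Type} [MeasurableSpace Ω] (Pm : MeasPotFrame D.carriers) {IOp : Type*} [NormedAddCommGroup IOp]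
      [NormedSpace ℂ IOp] (𝒵 : D.carriers.Dom → InnerLabel D.carriers.Dom (Bnd D.toTwoRuns) → Type) [∀ Z j, Fintype (𝒵 Z j)]
      (domZ : ∀ Z j, 𝒵 Z j → D.carriers.Dom) (Jc : D.carriers.Dom → InnerLabel D.carriers.Dom (Bnd D.toTwoRuns) → Type)
      [∀ Z j, Fintype (Jc Z j)] (Vv : D.carriers.Dom → InnerLabel D.carriers.Dom (Bnd D.toTwoRuns) → Type)
      [∀ Z j, NormedAddCommGroup (Vv Z j)] [∀ Z j, InnerProductSpace ℝ (Vv Z j)] [∀ Z j, MeasurableSpace (Vv Z j)] [∀ Z j, BorelSpace (Vv Z j)]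
      [∀ Z j, FiniteDimensional ℝ (Vv Z j)] (mI : D.carriers.Dom → InnerLabel D.carriers.Dom (Bnd D.toTwoRuns) → Type)
      [∀ Z j, Fintype (mI Z j)] [∀ Z j, DecidableEq (mI Z j)]
      (Lsl : SlotLetters D (o := oc) (T := T) (ι' := ι') (S := Sy) (Ω := Ω) (𝒴 := 𝒴) Pm (IOp := IOp) 𝒵 domZ Jc Vv mI)
      (hbdA : ∀ (g : ℕ → ℝ) (U : D.carriers.BgA) (k : ℕ),
        FormatBounded (Lsl.W k).format (rawAOfRecord ιr D cc ag sg Lsl.ΓA Lsl.dkA Lsl.gcA Lsl.pQA Lsl.pRA g U k).kernel)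
      (hmQA : ∀ (r : ℝ) (U : GaugeField (D.F.P D.K) 0 𝔾) (k : ℕ) (Y : 𝒴) (b b' : ((Tor (unitMod (D.F.P D.K)) × Fin (D.F.P D.K).d) × oc)),
        Measurable fun x : Ω => Lsl.pQA r U k x Y b b')
      (hmRA : ∀ (r : ℝ) (U : GaugeField (D.F.P D.K) 0 𝔾) (k : ℕ) (Y : 𝒴), Measurable fun x : Ω => Lsl.pRA r U k x Y)
      (hbdB : ∀ (g : ℕ → ℝ) (U : D.carriers.BgB) (k : ℕ),
        FormatBounded (Lsl.W k).format (rawBOfRecord ιr D cc ag sg Lsl.ΓB Lsl.dkB Lsl.gcB Lsl.pQB Lsl.pRB g U k).kernel)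
      (hmQB : ∀ (r : ℝ) (U : GaugeField (D.F.P (D.K + 1)) 0 𝔾) (k : ℕ) (Y : 𝒴) (b b' : ((Tor (unitMod (D.F.P D.K)) × Fin (D.F.P D.K).d) × oc)),
        Measurable fun x : Ω => Lsl.pQB r U k x Y b b')
      (hmRB : ∀ (r : ℝ) (U : GaugeField (D.F.P (D.K + 1)) 0 𝔾) (k : ℕ) (Y : 𝒴), Measurable fun x : Ω => Lsl.pRB r U k x Y)
      (iopAt : ℝ → D.carriers.BgA → ℕ → IOp)
      (hiopA : ∀ (r : ℝ) (U : D.carriers.BgB) (k : ℕ), Lsl.ins.iopA r U k = iopAt r (D.carriers.transport U) k)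
      {𝒞 : ℕ → Set (B7Prop1Explicit.Site d → Fin d → (Matrix o o ℂ)ˣ)} {Nl : ℕ}
      {dom : Set (B7Prop1Explicit.Site d → Fin d → (Matrix o o ℂ)ˣ)}
      {RgV : (B7Prop1Explicit.Site d → Fin d → (Matrix o o ℂ)ˣ) → ((k : ℕ) → Fin d → (Tor (fine (lev L k) M) → Matrix o o ℂ))}
      {tow : ℕ → (ℕ → ℝ) → D.toTwoRuns.carriers.BgB → ↥dom} {W : Set (ℕ → ℝ)}
      {σ : T → ((Tor (unitMod (D.F.P D.K)) × Fin (D.F.P D.K).d) × oc) → idx L M 0 × o} {dist₁ : idx L M 0 × o → idx L M 0 × o → ℝ} {δ₁ : ℝ}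
      {S₂ : Set (Matrix (idx L M 0 × o) (idx L M 0 × o) ℂ)} {Φ : T → Matrix (idx L M 0 × o) (idx L M 0 × o) ℂ → Matrix m m ℂ}
      {dist₂ : m → m → ℝ} {δ₂ : ℝ} {σX : T → ι' → m}
      {S₃ : Set (Matrix (idx L M 0 × o) (idx L M 0 × o) ℂ)} {Ψ : T → Matrix (idx L M 0 × o) (idx L M 0 × o) ℂ → Matrix m m ℂ}
      {dist₃ : m → m → ℝ} {δ₃ : ℝ} {σB : T → ((Tor (unitMod (D.F.P D.K)) × Fin (D.F.P D.K).d) × oc) → m}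
      {ROp RHist : ℕ → ℝ}
      {N A A' Aop Aop' : ℕ → (ℕ → ℝ) → D.toTwoRuns.carriers.BgB → D.toTwoRuns.carriers.Dom →
        InnerLabel D.toTwoRuns.carriers.Dom (Bnd D.toTwoRuns) → ℝ}
      {Dt : ActData D.toTwoRuns.carriers.Dom (InnerLabel D.toTwoRuns.carriers.Dom (Bnd D.toTwoRuns))
        (measOp T ((Tor (unitMod (D.F.P D.K)) × Fin (D.F.P D.K).d) × oc) ι' Ω 𝒴) (B13HistM Pm) Ω} {rI : ℕ → ℝ} {hrI : ∀ k, 0 < rI k}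
      {Cfg : ℕ → Type*} [∀ k, NormedAddCommGroup (Cfg k)] [∀ k, NormedSpace ℂ (Cfg k)] {cfg : ∀ k, IOp → Cfg k}
      {Φc : ∀ k, (D.toTwoRuns.carriers.Dom → ℝ) → Cfg k → B13HistM Pm} {𝒪 : ℕ → (ℕ → ℝ) → D.toTwoRuns.carriers.BgB → Set IOp}
      {Dc : ∀ k, (ℕ → ℝ) → D.toTwoRuns.carriers.BgB → Set (Cfg k)},
      Lsl.ins.ω = ω →
      (∀ V ∈ dom, RegularTransporters L M (liftR L M (RgV V)) α β) →
      NE3Shape (minActReadings d 𝒞 L Nl dom (ne2Loc L M fun V => liftR L M (RgV V))) C θ →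
      (∀ V ∈ dom, ∀ k, EntryDecay dist₁
        (pertCovC L M a ha (balabanPert L M a (liftR L M (RgV V)) (gaugeSlot L M (RgV V) (QuT L M o (siteT L M (RgV V))) (Q1 L M o) a'))
          1 k) B₁ δ₁) →
      ReadsTowerCovA
        (fun V : ↥dom => pertCovC L M a ha
          (balabanPert L M a (liftR L M (RgV V)) (gaugeSlot L M (RgV V) (QuT L M o (siteT L M (RgV V))) (Q1 L M o) a')) 1)
        σ tow (fun g U k => (rawAOfRecord ιr D cc ag sg Lsl.ΓA Lsl.dkA Lsl.gcA Lsl.pQA Lsl.pRA) g (D.toTwoRuns.carriers.transport U) k) W →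
      ReadsTowerCovB
        (fun V : ↥dom => pertCovC L M a ha
          (balabanPert L M a (liftR L M (RgV V)) (gaugeSlot L M (RgV V) (QuT L M o (siteT L M (RgV V))) (Q1 L M o) a')) 1)
        σ tow (rawBOfRecord ιr D cc ag sg Lsl.ΓB Lsl.dkB Lsl.gcB Lsl.pQB Lsl.pRB) W →
      CovWeightDominatesDist (slotsOfRecord D ιr cc ag sg Pm 𝒵 domZ Jc Vv mI Lsl).F dist₁ σ (δ₁ / 2) →
      (∀ t, OpLipschitzOn S₂ (Φ t) Λ₂) →
      (∀ V ∈ dom, ∀ k, pertCovC L M a ha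
        (balabanPert L M a (liftR L M (RgV V)) (gaugeSlot L M (RgV V) (QuT L M o (siteT L M (RgV V))) (Q1 L M o) a')) 1 k ∈ S₂) →
      (∀ V ∈ dom, ∀ t k, EntryDecay dist₂ (Φ t (pertCovC L M a ha
        (balabanPert L M a (liftR L M (RgV V)) (gaugeSlot L M (RgV V) (QuT L M o (siteT L M (RgV V))) (Q1 L M o) a')) 1 k)) B₂ δ₂) →
      ReadsTowerDeltaA (fun (V : ↥dom) t k => Φ t (pertCovC L M a ha
        (balabanPert L M a (liftR L M (RgV V)) (gaugeSlot L M (RgV V) (QuT L M o (siteT L M (RgV V))) (Q1 L M o) a')) 1 k))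
        σX tow (fun g U k => (rawAOfRecord ιr D cc ag sg Lsl.ΓA Lsl.dkA Lsl.gcA Lsl.pQA Lsl.pRA) g (D.toTwoRuns.carriers.transport U) k) W →
      ReadsTowerDeltaB (fun (V : ↥dom) t k => Φ t (pertCovC L M a ha
        (balabanPert L M a (liftR L M (RgV V)) (gaugeSlot L M (RgV V) (QuT L M o (siteT L M (RgV V))) (Q1 L M o) a')) 1 k))
        σX tow (rawBOfRecord ιr D cc ag sg Lsl.ΓB Lsl.dkB Lsl.gcB Lsl.pQB Lsl.pRB) W →
      DeltaWeightDominatesDist (slotsOfRecord D ιr cc ag sg Pm 𝒵 domZ Jc Vv mI Lsl).F dist₂ σX (δ₂ / 2) →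
      (∀ t, OpLipschitzOn S₃ (Ψ t) Λ₃) →
      (∀ V ∈ dom, ∀ k, pertCovC L M a ha
        (balabanPert L M a (liftR L M (RgV V)) (gaugeSlot L M (RgV V) (QuT L M o (siteT L M (RgV V))) (Q1 L M o) a')) 1 k ∈ S₃) →
      (∀ V ∈ dom, ∀ t k, EntryDecay dist₃ (Ψ t (pertCovC L M a ha
        (balabanPert L M a (liftR L M (RgV V)) (gaugeSlot L M (RgV V) (QuT L M o (siteT L M (RgV V))) (Q1 L M o) a')) 1 k)) B₃ δ₃) →
      ReadsTowerGammaA (fun (V : ↥dom) t k => Ψ t (pertCovC L M a ha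
        (balabanPert L M a (liftR L M (RgV V)) (gaugeSlot L M (RgV V) (QuT L M o (siteT L M (RgV V))) (Q1 L M o) a')) 1 k))
        σB σX tow (fun g U k => (rawAOfRecord ιr D cc ag sg Lsl.ΓA Lsl.dkA Lsl.gcA Lsl.pQA Lsl.pRA) g (D.toTwoRuns.carriers.transport U) k) W →
      ReadsTowerGammaB (fun (V : ↥dom) t k => Ψ t (pertCovC L M a ha
        (balabanPert L M a (liftR L M (RgV V)) (gaugeSlot L M (RgV V) (QuT L M o (siteT L M (RgV V))) (Q1 L M o) a')) 1 k))
        σB σX tow (rawBOfRecord ιr D cc ag sg Lsl.ΓB Lsl.dkB Lsl.gcB Lsl.pQB Lsl.pRB) W →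
      GammaWeightDominatesDist (slotsOfRecord D ιr cc ag sg Pm 𝒵 domZ Jc Vv mI Lsl).F dist₃ σB σX (δ₃ / 2) →
      PotQLipschitzReading (minActReadings d 𝒞 L Nl dom (ne2Loc L M fun V => liftR L M (RgV V))) (slotsOfRecord D ιr cc ag sg Pm 𝒵 domZ Jc Vv mI Lsl).F
        (fun g U k => (rawAOfRecord ιr D cc ag sg Lsl.ΓA Lsl.dkA Lsl.gcA Lsl.pQA Lsl.pRA) g (D.toTwoRuns.carriers.transport U) k)
        (rawBOfRecord ιr D cc ag sg Lsl.ΓB Lsl.dkB Lsl.gcB Lsl.pQB Lsl.pRB) W Λ₄ →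
      PotRLipschitzReading (minActReadings d 𝒞 L Nl dom (ne2Loc L M fun V => liftR L M (RgV V))) (slotsOfRecord D ιr cc ag sg Pm 𝒵 domZ Jc Vv mI Lsl).F
        (fun g U k => (rawAOfRecord ιr D cc ag sg Lsl.ΓA Lsl.dkA Lsl.gcA Lsl.pQA Lsl.pRA) g (D.toTwoRuns.carriers.transport U) k)
        (rawBOfRecord ιr D cc ag sg Lsl.ΓB Lsl.dkB Lsl.gcB Lsl.pQB Lsl.pRB) W Λ₅ →
      (assembly (slotsOfRecord D ιr cc ag sg Pm 𝒵 domZ Jc Vv mI Lsl)).SliceBudgetB W κ cB →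
      (slotsOfRecord D ιr cc ag sg Pm 𝒵 domZ Jc Vv mI Lsl).D.SliceBudget (step (slotsOfRecord D ιr cc ag sg Pm 𝒵 domZ Jc Vv mI Lsl) E₀ cB) W κ cA →
      DecayBound (B13StepOfRecord.outA (slotsOfRecord D ιr cc ag sg Pm 𝒵 domZ Jc Vv mI Lsl) E₀ cB) W EA₀ κ →
      DecayBound (B13StepOfRecord.outB (slotsOfRecord D ιr cc ag sg Pm 𝒵 domZ Jc Vv mI Lsl) E₀ cB) W E₀ κ →
      RawBounded (slotsOfRecord D ιr cc ag sg Pm 𝒵 domZ Jc Vv mI Lsl).F (assembly (slotsOfRecord D ιr cc ag sg Pm 𝒵 domZ Jc Vv mI Lsl)).rawAt W →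
      RawBounded (slotsOfRecord D ιr cc ag sg Pm 𝒵 domZ Jc Vv mI Lsl).F (slotsOfRecord D ιr cc ag sg Pm 𝒵 domZ Jc Vv mI Lsl).rawB W →
      (∀ k, r₀ ≤ Lsl.rOp k) →
      InsOpComposition ((slotsOfRecord D ιr cc ag sg Pm 𝒵 domZ Jc Vv mI Lsl).D.toInsOpModel (step (slotsOfRecord D ιr cc ag sg Pm 𝒵 domZ Jc Vv mI Lsl) E₀ cB) rI hrI)
          W κ E₀ Gi cfg Φc 𝒪 Dc →
      (∀ k, ∀ g ∈ W, ∀ (U : D.toTwoRuns.carriers.BgB),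
        ((slotsOfRecord D ιr cc ag sg Pm 𝒵 domZ Jc Vv mI Lsl).D.toInsOpModel (step (slotsOfRecord D ιr cc ag sg Pm 𝒵 domZ Jc Vv mI Lsl) E₀ cB)
          rI hrI).opIA g U k ∈ 𝒪 k g U) →
      ((slotsOfRecord D ιr cc ag sg Pm 𝒵 domZ Jc Vv mI Lsl).D.toInsOpModel (step (slotsOfRecord D ιr cc ag sg Pm 𝒵 domZ Jc Vv mI Lsl) E₀ cB) rI hrI).InsOpRate W δI (Real.sqrt (max θ ((L : ℝ)⁻¹))) →
      ActOpFibre (labelsIndexing (domainGeometry D.toTwoRuns) (b13InnerData D.toTwoRuns))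
        (restrict (slotsOfRecord D ιr cc ag sg Pm 𝒵 domZ Jc Vv mI Lsl) (measOp T ((Tor (unitMod (D.F.P D.K)) × Fin (D.F.P D.K).d) × oc) ι' Ω 𝒴)
          (opA_mem_measOp_slotsOfRecord D ιr cc ag sg Pm 𝒵 domZ Jc Vv mI Lsl hbdA hmQA hmRA) (opB_mem_measOp_slotsOfRecord D ιr cc ag sg Pm 𝒵 domZ Jc Vv mI Lsl hbdB
            hmQB hmRB)).act
        (stepOn (restrict (slotsOfRecord D ιr cc ag sg Pm 𝒵 domZ Jc Vv mI Lsl) (measOp T ((Tor (unitMod (D.F.P D.K)) × Fin (D.F.P D.K).d) × oc) ι' Ω 𝒴)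
          (opA_mem_measOp_slotsOfRecord D ιr cc ag sg Pm 𝒵 domZ Jc Vv mI Lsl hbdA hmQA hmRA) (opB_mem_measOp_slotsOfRecord D ιr cc ag sg Pm 𝒵 domZ Jc Vv mI Lsl hbdB
            hmQB hmRB)) E₀ cB) W Aop →
      (∀ k g U Z ℓ, 0 ≤ Aop k g U Z ℓ) → (∀ k g U Z ℓ, 0 ≤ Aop' k g U Z ℓ) →
      (∀ k g U Z ℓ, Aop k g U Z ℓ ≤ Aop' k g U Z ℓ * Real.exp (-(κ * (D.toTwoRuns.carriers.d Z + 5)))) →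
      (∀ k, ∀ g ∈ W, ∀ (U : D.toTwoRuns.carriers.BgB), ∀ Z ∈ D.toTwoRuns.domAt k,
        actSum (b13InnerData D.toTwoRuns) (Aop' k g U) k Z ≤ εop * Real.exp (-(Rt * D.toTwoRuns.carriers.d Z))) →
      ActExpLinearOn (labelsIndexing (domainGeometry D.toTwoRuns) (b13InnerData D.toTwoRuns))
        (restrict (slotsOfRecord D ιr cc ag sg Pm 𝒵 domZ Jc Vv mI Lsl) (measOp T ((Tor (unitMod (D.F.P D.K)) × Fin (D.F.P D.K).d) × oc) ι' Ω 𝒴)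
          (opA_mem_measOp_slotsOfRecord D ιr cc ag sg Pm 𝒵 domZ Jc Vv mI Lsl hbdA hmQA hmRA) (opB_mem_measOp_slotsOfRecord D ιr cc ag sg Pm 𝒵 domZ Jc Vv mI Lsl hbdB
            hmQB hmRB)).act Dt
        (ballClass (selfCtr
          (assemblyOn (restrict (slotsOfRecord D ιr cc ag sg Pm 𝒵 domZ Jc Vv mI Lsl) (measOp T ((Tor (unitMod (D.F.P D.K)) × Fin (D.F.P D.K).d) × oc) ι' Ω 𝒴)
            (opA_mem_measOp_slotsOfRecord D ιr cc ag sg Pm 𝒵 domZ Jc Vv mI Lsl hbdA hmQA hmRA) (opB_mem_measOp_slotsOfRecord D ιr cc ag sg Pm 𝒵 domZ Jc Vv mI Lsl hbdB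
              hmQB hmRB))).raw
          (assemblyOn (restrict (slotsOfRecord D ιr cc ag sg Pm 𝒵 domZ Jc Vv mI Lsl) (measOp T ((Tor (unitMod (D.F.P D.K)) × Fin (D.F.P D.K).d) × oc) ι' Ω 𝒴)
            (opA_mem_measOp_slotsOfRecord D ιr cc ag sg Pm 𝒵 domZ Jc Vv mI Lsl hbdA hmQA hmRA) (opB_mem_measOp_slotsOfRecord D ιr cc ag sg Pm 𝒵 domZ Jc Vv mI Lsl hbdB
              hmQB hmRB))).histRef) ROp RHist) W →
      ActExpNormBound (labelsIndexing (domainGeometry D.toTwoRuns) (b13InnerData D.toTwoRuns)) Dt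
        (ballClass (selfCtr
          (assemblyOn (restrict (slotsOfRecord D ιr cc ag sg Pm 𝒵 domZ Jc Vv mI Lsl) (measOp T ((Tor (unitMod (D.F.P D.K)) × Fin (D.F.P D.K).d) × oc) ι' Ω 𝒴)
            (opA_mem_measOp_slotsOfRecord D ιr cc ag sg Pm 𝒵 domZ Jc Vv mI Lsl hbdA hmQA hmRA) (opB_mem_measOp_slotsOfRecord D ιr cc ag sg Pm 𝒵 domZ Jc Vv mI Lsl hbdB
              hmQB hmRB))).raw
          (assemblyOn (restrict (slotsOfRecord D ιr cc ag sg Pm 𝒵 domZ Jc Vv mI Lsl) (measOp T ((Tor (unitMod (D.F.P D.K)) × Fin (D.F.P D.K).d) × oc) ι' Ω 𝒴)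
            (opA_mem_measOp_slotsOfRecord D ιr cc ag sg Pm 𝒵 domZ Jc Vv mI Lsl hbdA hmQA hmRA) (opB_mem_measOp_slotsOfRecord D ιr cc ag sg Pm 𝒵 domZ Jc Vv mI Lsl hbdB
              hmQB hmRB))).histRef) ROp RHist) W
        Lsl.rHist N →
      (∀ k g U Z ℓ, 0 ≤ N k g U Z ℓ) → (∀ k g U Z ℓ, N k g U Z ℓ ≤ Nbar) →
      ActAbsBound (labelsIndexing (domainGeometry D.toTwoRuns) (b13InnerData D.toTwoRuns)) Dt
        (ballClass (selfCtr
          (assemblyOn (restrict (slotsOfRecord D ιr cc ag sg Pm 𝒵 domZ Jc Vv mI Lsl) (measOp T ((Tor (unitMod (D.F.P D.K)) × Fin (D.F.P D.K).d) × oc) ι' Ω 𝒴)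
            (opA_mem_measOp_slotsOfRecord D ιr cc ag sg Pm 𝒵 domZ Jc Vv mI Lsl hbdA hmQA hmRA) (opB_mem_measOp_slotsOfRecord D ιr cc ag sg Pm 𝒵 domZ Jc Vv mI Lsl hbdB
              hmQB hmRB))).raw
          (assemblyOn (restrict (slotsOfRecord D ιr cc ag sg Pm 𝒵 domZ Jc Vv mI Lsl) (measOp T ((Tor (unitMod (D.F.P D.K)) × Fin (D.F.P D.K).d) × oc) ι' Ω 𝒴)
            (opA_mem_measOp_slotsOfRecord D ιr cc ag sg Pm 𝒵 domZ Jc Vv mI Lsl hbdA hmQA hmRA) (opB_mem_measOp_slotsOfRecord D ιr cc ag sg Pm 𝒵 domZ Jc Vv mI Lsl hbdB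
              hmQB hmRB))).histRef) ROp RHist) W A →
      (∀ k g U Z ℓ, 0 ≤ A k g U Z ℓ) → (∀ k g U Z ℓ, 0 ≤ A' k g U Z ℓ) →
      (∀ k g U Z ℓ, A k g U Z ℓ ≤ A' k g U Z ℓ * Real.exp (-(κ * (D.toTwoRuns.carriers.d Z + 5)))) →
      (∀ k, ∀ g ∈ W, ∀ (U : D.toTwoRuns.carriers.BgB), ∀ Z ∈ D.toTwoRuns.domAt k,
        actSum (b13InnerData D.toTwoRuns) (A' k g U) k Z ≤ ε * Real.exp (-(Rt * D.toTwoRuns.carriers.d Z))) →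
      (∀ k, (Real.sqrt (2 * B₁ * (2 * CpertRec o d L a α β C a' / (1 - max θ ((L : ℝ)⁻¹)))) +
          Real.sqrt (2 * B₂ * (Λ₂ * CpertRec o d L a α β C a')) + Real.sqrt (2 * B₃ * (Λ₃ * CpertRec o d L a α β C a')) +
          Λ₄ * C + Λ₅ * C) / r₀ * Lsl.rOp k ≤ ROp k) → (∀ k, (assembly (slotsOfRecord D ιr cc ag sg Pm 𝒵 domZ Jc Vv mI Lsl)).bHist E₀ cB k ≤ RHist k) →
      (∀ k, (Gi * δI / (1 - ρ₁) + 2 * Gi / Real.sqrt (max θ ((L : ℝ)⁻¹)) ^ k₁) * Lsl.rHist k + EA₀ * (Lsl.rHist k * (cA / (1 - ω))) ≤ RHist k) →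
      NE5 (B13StepOfRecord.outA (slotsOfRecord D ιr cc ag sg Pm 𝒵 domZ Jc Vv mI Lsl) E₀ cB)
        (B13StepOfRecord.outB (slotsOfRecord D ιr cc ag sg Pm 𝒵 domZ Jc Vv mI Lsl) E₀ cB) W κ θ' C₅ := by
  obtain ⟨hΘ0, hΘ1⟩ := sqrt_rate_pos_lt_one L hL hθ1
  obtain ⟨C₅, h⟩ := uniform_ne5_of_substrate_restrict_secant_structural (k₁ := k₁) (κ := κ)
    (c₁ := (Real.sqrt (2 * B₁ * (2 * CpertRec o d L a α β C a' / (1 - max θ ((L : ℝ)⁻¹)))) + Real.sqrt (2 * B₂ * (Λ₂ * CpertRec o d L a α β C a')) + Real.sqrt (2 * B₃ * (Λ₃ * CpertRec o d L a α β C a')) + Λ₄ * C + Λ₅ * C))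
    hκ hNbar hε hεop hRt hΦsmall hΦopsmall hEA₀ hE₀ hcA hcB (c1_balaban_nonneg L a hC hΛ₄ hΛ₅) hr₀ hGi hδI hρ₁ hreachI hΘ0 hΘ1 hθθ' hθ'1
    hω hω1 hρ₀ hρ₀1 hsmall
  refine ⟨C₅, ?_⟩
  intro 𝔾 _ D oc _ _ ιr cc ag sg T ι' Sy Ω 𝒴 _ Pm IOp _ _ 𝒵 _ domZ Jc _ Vv _ _ _ _ _ mI _ _ Lsl hbdA hmQA hmRA hbdB hmQB hmRB iopAt hiopA 𝒞 Nl dom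
    RgV tow W σ dist₁ δ₁ S₂ Φ dist₂ δ₂ σX S₃ Ψ dist₃ δ₃ σB ROp RHist N A A' Aop Aop' Dt rI hrI Cfg _ _ cfg Φc 𝒪 Dc hLω hreg hNE3 hdec hcovA
    hcovB hdom₁ hΦ hS₂ hdecΦ hΔA hΔB hdom₂ hΨ hS₃ hdecΨ hΓA hΓB hdom₃ hQ hR hbB hbA hdA hdB hRA hRB hfl hcomp hIA hirate hfib hAop0 hAop0'
    hdecop h238op hexp hN hN0 hNle habs hA0 hA0' hdecAct h238 hOp hHist hHistA
  exact h D ιr cc ag sg Pm 𝒵 domZ Jc Vv mI Lsl hbdA hmQA hmRA hbdB hmQB hmRB iopAt hiopA hLω hbB hbA hdA hdB hRA hRB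
    (weightedEntrywiseRate_slotsOfRecord_balaban_ne3Shape D ιr cc ag sg Pm 𝒵 domZ Jc Vv mI Lsl L M a ha hL hd hreg hα hβ hC hNE3 ha' hαη hβη
      hη hdec hcovA hcovB hdom₁ hΦ hΛ₂ hS₂ hdecΦ hΔA hΔB hdom₂ hΨ hΛ₃ hS₃ hdecΨ hΓA hΓB hdom₃ hΛ₄ hΛ₅ hQ hR)
    hfl hcomp hIA hirate hfib hAop0 hAop0' hdecop h238op hexp hN hN0 hNle habs hA0 hA0' hdecAct h238 hOp hHist hHistA

end Uniform

end Summit.QuantumFields.BalabanUV.T4Continuum.B13StepOfRecordSubstrateBalabanUniform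

end
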